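import Summits.KontsevichZagierPeriods.Zeta5Search.Barrier.ConeGammaCritRootTracking

/-!
# ζ(5) search — BARRIER: three root branches ⇒ three tracked critical values (abstract perturbation lemma)

HONEST FRAMING (cell `pub-zeta5`): systematic search; no irrationality claim unless kernel-certified. MODEL objects
under Brown–Zudilin's (28)+(30) accounting ([BZ22] = arXiv:2210.03391; (28) observed, not proved); this file is
elementary real analysis with NO Brown–Zudilin object in it (the cubic `C`, the side condition `G`, the value map
`V` and the value set `S` are variables); nothing here is a statement about the size of any critical value, the
cone's supremum (C2 = `BarrierC2`, OPEN), S-E (CONJECTURED) or `ζ(5)`. No number or sentence of record moves. Records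
in print UNMOVED. Prover P2 g23 (self-selected Lean-only item «BZ's cubic (20) in the kernel», file 3).

The perturbation argument behind «`Regular` is open and `C₀`, `C₁` are locally Lipschitz», abstractly. Data: a
family of functions `C s' : ℝ → ℝ` (the cubic), a side condition `G : E × ℝ → ℝ` (product of the quantities that
must not vanish at a critical point), a value map `V : E × ℝ → ℝ` (the growth functional at the critical point over
a root) and value sets `S s'` (the critical values), for parameters `s'` in a real normed space `E`.
* **`exists_root_branch`** — ONE BRANCH: if `(s', Y) ↦ C s' Y` is `C¹` at `(s, Y₁)`, every `C s'` is continuous,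
  `C s = a·(Y−Y₁)(Y−Y₂)(Y−Y₃)` with `a ≠ 0` and `Y₁ ≠ Y₂, Y₃`, `G` is continuous and non-zero at `(s, Y₁)` and `V`
  is `C¹` there, then for `‖s' − s‖ ≤ η` there is a root `Y` of `C s'` with `G(s', Y) ≠ 0` and
  `|V(s', Y) − V(s, Y₁)| ≤ M·‖s' − s‖` (`ConeGammaCritRootTracking.exists_root_near` + the two ball lemmas).
* **`exists_three_branches`** — THREE BRANCHES: under the same hypotheses at three simple roots with values
  `V(s,Y₁) < V(s,Y₂) < V(s,Y₃)`, if roots with the side condition give elements of `S s'` (`hcrit`) and `S s'` is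
  finite with at most three elements near `s` (`hcount`), then for `‖s' − s‖ ≤ η`:
  `S s' = {v₁, v₂, v₃}` with `v₁ < v₂ < v₃` and `|vᵢ − V(s, Yᵢ)| ≤ M·‖s' − s‖`.
-/

noncomputable section

open Set Metric
open scoped Topology

namespace Summit.KontsevichZagierPeriods.Zeta5Search.Barrier.ConeGamma

/-! ### One branch -/

/-- **One root branch with its side condition and value.** See the module docstring. -/
theorem exists_root_branch {E : Type*} [NormedAddCommGroup E] [NormedSpace ℝ E]
    {C : E → ℝ → ℝ} {G V : E × ℝ → ℝ} {s : E} {a Y₁ Y₂ Y₃ : ℝ}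
    (hCdiff : ContDiffAt ℝ 1 (fun p : E × ℝ => C p.1 p.2) (s, Y₁)) (hCcont : ∀ s', Continuous (C s'))
    (hbase : ∀ Y, C s Y = a * ((Y - Y₁) * (Y - Y₂) * (Y - Y₃))) (ha : a ≠ 0) (h12 : Y₁ ≠ Y₂) (h13 : Y₁ ≠ Y₃)
    (hGc : ContinuousAt G (s, Y₁)) (hG0 : G (s, Y₁) ≠ 0) (hV : ContDiffAt ℝ 1 V (s, Y₁)) :
    ∃ η M : ℝ, 0 < η ∧ 0 ≤ M ∧ ∀ s', ‖s' - s‖ ≤ η →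
      ∃ Y, C s' Y = 0 ∧ G (s', Y) ≠ 0 ∧ |V (s', Y) - V (s, Y₁)| ≤ M * ‖s' - s‖ := by
  obtain ⟨K, ηK, hK, hηK, hlipC⟩ := exists_local_lipschitz_of_contDiffAt hCdiff
  have hlip : ∀ s' Y, ‖s' - s‖ ≤ ηK → |Y - Y₁| ≤ ηK → |C s' Y - C s Y| ≤ K * ‖s' - s‖ := by
    intro s' Y hs hY
    have h := hlipC s' Y s Y hs hY (by rw [sub_self, norm_zero]; exact hηK.le) hY
    rw [sub_self, abs_zero, max_eq_left (norm_nonneg _)] at h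
    exact h
  obtain ⟨L, ηL, hL, hηL, _, _, hroot⟩ :=
    exists_root_near hηK hK hlip (fun s' _ => (hCcont s').continuousOn) hbase ha h12 h13
  obtain ⟨ηG, hηG, hGne⟩ := exists_ball_ne_zero hGc hG0
  obtain ⟨KV, ηV, hKV, hηV, hlipV⟩ := exists_local_lipschitz_of_contDiffAt hV
  have hL1 : 1 ≤ L + 1 := by linarith
  refine ⟨min ηL (min (ηG / (L + 1)) (ηV / (L + 1))), KV * (L + 1), by positivity, by positivity,
    fun s' hs' => ?_⟩
  have hsL : ‖s' - s‖ ≤ ηL := hs'.trans (min_le_left _ _)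
  have hsG' : ‖s' - s‖ ≤ ηG / (L + 1) := hs'.trans ((min_le_right _ _).trans (min_le_left _ _))
  have hsV' : ‖s' - s‖ ≤ ηV / (L + 1) := hs'.trans ((min_le_right _ _).trans (min_le_right _ _))
  have hsG : ‖s' - s‖ ≤ ηG := hsG'.trans (div_le_self hηG.le hL1)
  have hsV : ‖s' - s‖ ≤ ηV := hsV'.trans (div_le_self hηV.le hL1)
  obtain ⟨Y, hY0, hYd⟩ := hroot s' hsL
  have hLfrac : ∀ t : ℝ, 0 ≤ t → L * (t / (L + 1)) ≤ t := by
    intro t ht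
    rw [mul_div_assoc', div_le_iff₀ (by positivity)]
    nlinarith
  have hYG : |Y - Y₁| ≤ ηG :=
    hYd.trans ((mul_le_mul_of_nonneg_left hsG' hL.le).trans (hLfrac ηG hηG.le))
  have hYV : |Y - Y₁| ≤ ηV :=
    hYd.trans ((mul_le_mul_of_nonneg_left hsV' hL.le).trans (hLfrac ηV hηV.le))
  refine ⟨Y, hY0, hGne s' Y (by rwa [dist_eq_norm]) hYG, ?_⟩
  have h := hlipV s' Y s Y₁ hsV hYV (by rw [sub_self, norm_zero]; exact hηV.le)
    (by rw [sub_self, abs_zero]; exact hηV.le)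
  have hmax : max ‖s' - s‖ |Y - Y₁| ≤ (L + 1) * ‖s' - s‖ := by
    refine max_le ?_ ?_
    · nlinarith [norm_nonneg (s' - s)]
    · nlinarith [norm_nonneg (s' - s)]
  calc |V (s', Y) - V (s, Y₁)| ≤ KV * max ‖s' - s‖ |Y - Y₁| := h
    _ ≤ KV * ((L + 1) * ‖s' - s‖) := mul_le_mul_of_nonneg_left hmax hKV
    _ = KV * (L + 1) * ‖s' - s‖ := by ring

/-! ### Three branches -/

/-- **Three root branches give exactly three tracked values.** See the module docstring. -/
theorem exists_three_branches {E : Type*} [NormedAddCommGroup E] [NormedSpace ℝ E]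
    {C : E → ℝ → ℝ} {G V : E × ℝ → ℝ} {S : E → Set ℝ} {s : E} {a Y₁ Y₂ Y₃ ηc : ℝ}
    (hCdiff : ∀ Y, ContDiffAt ℝ 1 (fun p : E × ℝ => C p.1 p.2) (s, Y)) (hCcont : ∀ s', Continuous (C s'))
    (hbase : ∀ Y, C s Y = a * ((Y - Y₁) * (Y - Y₂) * (Y - Y₃))) (ha : a ≠ 0)
    (h12 : Y₁ ≠ Y₂) (h13 : Y₁ ≠ Y₃) (h23 : Y₂ ≠ Y₃)
    (hG₁ : ContinuousAt G (s, Y₁)) (hG₂ : ContinuousAt G (s, Y₂)) (hG₃ : ContinuousAt G (s, Y₃))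
    (hG₁0 : G (s, Y₁) ≠ 0) (hG₂0 : G (s, Y₂) ≠ 0) (hG₃0 : G (s, Y₃) ≠ 0)
    (hV₁ : ContDiffAt ℝ 1 V (s, Y₁)) (hV₂ : ContDiffAt ℝ 1 V (s, Y₂)) (hV₃ : ContDiffAt ℝ 1 V (s, Y₃))
    (hv12 : V (s, Y₁) < V (s, Y₂)) (hv23 : V (s, Y₂) < V (s, Y₃)) (hηc : 0 < ηc)
    (hcrit : ∀ s' Y, ‖s' - s‖ ≤ ηc → C s' Y = 0 → G (s', Y) ≠ 0 → V (s', Y) ∈ S s')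
    (hcount : ∀ s', ‖s' - s‖ ≤ ηc → (S s').Finite ∧ (S s').ncard ≤ 3) :
    ∃ η M : ℝ, 0 < η ∧ η ≤ ηc ∧ 0 ≤ M ∧ ∀ s', ‖s' - s‖ ≤ η →
      ∃ v₁ v₂ v₃ : ℝ, S s' = {v₁, v₂, v₃} ∧ v₁ < v₂ ∧ v₂ < v₃ ∧
        |v₁ - V (s, Y₁)| ≤ M * ‖s' - s‖ ∧ |v₂ - V (s, Y₂)| ≤ M * ‖s' - s‖ ∧ |v₃ - V (s, Y₃)| ≤ M * ‖s' - s‖ := by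
  -- the three branches
  obtain ⟨η₁, M₁, hη₁, hM₁, hb₁⟩ := exists_root_branch (hCdiff Y₁) hCcont hbase ha h12 h13 hG₁ hG₁0 hV₁
  obtain ⟨η₂, M₂, hη₂, hM₂, hb₂⟩ := exists_root_branch (Y₂ := Y₁) (Y₃ := Y₃) (hCdiff Y₂) hCcont
    (fun Y => by rw [hbase]; ring) ha h12.symm h23 hG₂ hG₂0 hV₂
  obtain ⟨η₃, M₃, hη₃, hM₃, hb₃⟩ := exists_root_branch (Y₂ := Y₁) (Y₃ := Y₂) (hCdiff Y₃) hCcont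
    (fun Y => by rw [hbase]; ring) ha h13.symm h23.symm hG₃ hG₃0 hV₃
  -- the gap between the base values and the common constants
  obtain ⟨g, hgdef⟩ : ∃ g : ℝ, g = min (V (s, Y₂) - V (s, Y₁)) (V (s, Y₃) - V (s, Y₂)) := ⟨_, rfl⟩
  have hg : 0 < g := by rw [hgdef]; exact lt_min (by linarith) (by linarith)
  have hg1 : g ≤ V (s, Y₂) - V (s, Y₁) := by rw [hgdef]; exact min_le_left _ _
  have hg2 : g ≤ V (s, Y₃) - V (s, Y₂) := by rw [hgdef]; exact min_le_right _ _
  obtain ⟨M, hMdef⟩ : ∃ M : ℝ, M = M₁ + M₂ + M₃ := ⟨_, rfl⟩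
  have hM : 0 ≤ M := by rw [hMdef]; positivity
  have hMM₁ : M₁ ≤ M := by rw [hMdef]; linarith
  have hMM₂ : M₂ ≤ M := by rw [hMdef]; linarith
  have hMM₃ : M₃ ≤ M := by rw [hMdef]; linarith
  obtain ⟨η, hηdef⟩ : ∃ η : ℝ, η = min (min η₁ (min η₂ η₃)) (min ηc (g / (4 * (M + 1)))) := ⟨_, rfl⟩
  have hη : 0 < η := by rw [hηdef]; positivity
  have hηc' : η ≤ ηc := by rw [hηdef]; exact (min_le_right _ _).trans (min_le_left _ _)
  refine ⟨η, M, hη, hηc', hM, fun s' hs' => ?_⟩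
  have hs₁ : ‖s' - s‖ ≤ η₁ := hs'.trans (by rw [hηdef]; exact (min_le_left _ _).trans (min_le_left _ _))
  have hs₂ : ‖s' - s‖ ≤ η₂ :=
    hs'.trans (by rw [hηdef]; exact (min_le_left _ _).trans ((min_le_right _ _).trans (min_le_left _ _)))
  have hs₃ : ‖s' - s‖ ≤ η₃ :=
    hs'.trans (by rw [hηdef]; exact (min_le_left _ _).trans ((min_le_right _ _).trans (min_le_right _ _)))
  have hsc : ‖s' - s‖ ≤ ηc := hs'.trans hηc'
  have hsg : ‖s' - s‖ ≤ g / (4 * (M + 1)) :=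
    hs'.trans (by rw [hηdef]; exact (min_le_right _ _).trans (min_le_right _ _))
  -- the separation `M ρ ≤ g/4`
  have hsep : M * ‖s' - s‖ ≤ g / 4 := by
    have h1 : M * ‖s' - s‖ ≤ M * (g / (4 * (M + 1))) := mul_le_mul_of_nonneg_left hsg hM
    have h2 : M * (g / (4 * (M + 1))) ≤ g / 4 := by
      rw [mul_div_assoc', div_le_div_iff₀ (by positivity) (by positivity)]
      nlinarith
    exact h1.trans h2
  obtain ⟨Z₁, hZ₁, hGZ₁, hVZ₁⟩ := hb₁ s' hs₁
  obtain ⟨Z₂, hZ₂, hGZ₂, hVZ₂⟩ := hb₂ s' hs₂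
  obtain ⟨Z₃, hZ₃, hGZ₃, hVZ₃⟩ := hb₃ s' hs₃
  have hd₁ : |V (s', Z₁) - V (s, Y₁)| ≤ M * ‖s' - s‖ :=
    hVZ₁.trans (mul_le_mul_of_nonneg_right hMM₁ (norm_nonneg _))
  have hd₂ : |V (s', Z₂) - V (s, Y₂)| ≤ M * ‖s' - s‖ :=
    hVZ₂.trans (mul_le_mul_of_nonneg_right hMM₂ (norm_nonneg _))
  have hd₃ : |V (s', Z₃) - V (s, Y₃)| ≤ M * ‖s' - s‖ :=
    hVZ₃.trans (mul_le_mul_of_nonneg_right hMM₃ (norm_nonneg _))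
  have e₁ := abs_le.mp hd₁
  have e₂ := abs_le.mp hd₂
  have e₃ := abs_le.mp hd₃
  have hlt12 : V (s', Z₁) < V (s', Z₂) := by linarith [e₁.2, e₂.1]
  have hlt23 : V (s', Z₂) < V (s', Z₃) := by linarith [e₂.2, e₃.1]
  -- the three values exhaust `S s'`
  have hsub : ({V (s', Z₁), V (s', Z₂), V (s', Z₃)} : Set ℝ) ⊆ S s' := by
    intro v hv
    simp only [Set.mem_insert_iff, Set.mem_singleton_iff] at hv
    rcases hv with rfl | rfl | rfl
    · exact hcrit s' Z₁ hsc hZ₁ hGZ₁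
    · exact hcrit s' Z₂ hsc hZ₂ hGZ₂
    · exact hcrit s' Z₃ hsc hZ₃ hGZ₃
  have hthree : ({V (s', Z₁), V (s', Z₂), V (s', Z₃)} : Set ℝ).ncard = 3 :=
    Set.ncard_eq_three.mpr ⟨_, _, _, hlt12.ne, (hlt12.trans hlt23).ne, hlt23.ne, rfl⟩
  obtain ⟨hfin, hle⟩ := hcount s' hsc
  have heq := Set.eq_of_subset_of_ncard_le hsub (by rw [hthree]; exact hle) hfin
  exact ⟨V (s', Z₁), V (s', Z₂), V (s', Z₃), heq.symm, hlt12, hlt23, hd₁, hd₂, hd₃⟩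

end Summit.KontsevichZagierPeriods.Zeta5Search.Barrier.ConeGamma

end
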